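import Mathlib.Analysis.Calculus.LineDeriv.IntegrationByParts
import Mathlib.Analysis.InnerProductSpace.Calculus
import Mathlib.Analysis.InnerProductSpace.PiL2
import Mathlib.MeasureTheory.Measure.Haar.InnerProductSpace
import Summits.PneNP.PneNP.Theses.LatticeMagic

/-!
# Route LatticeMagic — `TaylorMinorantsBuySqrtK` (stmt-PneNP-2329): the radial weight calculus

Helper file (1/3) for the proof of `Summit.PneNP.PneNP.Theses.LatticeMagic.TaylorMinorantsBuySqrtK`.
The proof averages the certificate polynomial against the radial weight
`x ↦ max (r² − ‖x‖²) 0` on `EuclideanSpace ℝ (Fin n)`.  Here we record the calculus of that weight: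

* the squared weight `(max (r² − ‖x‖²) 0)²` is `C¹` with line derivative `−4⟪x,v⟫ · max (r² − ‖x‖²) 0`;
* integration by parts against it (Mathlib's
  `integral_bilinear_hasLineDerivAt_right_eq_neg_left_of_integrable`);
* the two moment identities for `m_i(w) = ∫ ⟪w,x⟫^{2i} (r² − ‖x‖²)₊ dx` and
  `d_i(w) = ∫ ⟪w,x⟫^{2i} (r² − ‖x‖²)₊² dx`:
  `4 m_{i+1} = (2i+1)‖w‖² d_i` (direction `w`) and `(n+2i+4) d_i = 4r² m_i` (radial field,
  coordinate by coordinate), whence `(n+2i+4) m_{i+1} = (2i+1)‖w‖²r² m_i`.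

Everything is elementary (no sphere measure, no Gaussian); statements are kept definition-free so
that the files are pure proofs.
-/

open MeasureTheory
open scoped InnerProductSpace

namespace Summit.PneNP.PneNP.Theorems.TaylorMinorants

variable {n : ℕ}

/-- Outside the closed ball of radius `r` the weight `max (r² − ‖x‖²) 0` vanishes. -/
theorem wt_eq_zero_of_lt {r : ℝ} (hr : 0 ≤ r) {x : EuclideanSpace ℝ (Fin n)} (hx : r < ‖x‖) :
    max (r ^ 2 - ‖x‖ ^ 2) 0 = 0 := by
  have : r ^ 2 < ‖x‖ ^ 2 := pow_lt_pow_left₀ hx hr two_ne_zero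
  rw [max_eq_right]
  linarith

/-- The weight `max (r² − ‖x‖²) 0` is continuous. -/
theorem continuous_wt (r : ℝ) :
    Continuous fun x : EuclideanSpace ℝ (Fin n) => max (r ^ 2 - ‖x‖ ^ 2) 0 := by
  fun_prop

/-- A function multiplied by the weight has compact support. -/
theorem hasCompactSupport_mul_wt {r : ℝ} (hr : 0 ≤ r) (F : EuclideanSpace ℝ (Fin n) → ℝ) :
    HasCompactSupport (fun x => F x * max (r ^ 2 - ‖x‖ ^ 2) 0) := by
  refine HasCompactSupport.intro (isCompact_closedBall (0 : EuclideanSpace ℝ (Fin n)) r) ?_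
  intro x hx
  rw [Metric.mem_closedBall, dist_zero_right, not_le] at hx
  simp [wt_eq_zero_of_lt hr hx]

/-- Continuous functions vanishing outside the ball of radius `r` are integrable. -/
theorem integrable_of_eq_zero_outside {r : ℝ} {G : EuclideanSpace ℝ (Fin n) → ℝ}
    (hG : Continuous G) (h0 : ∀ x, r < ‖x‖ → G x = 0) : Integrable G := by
  refine hG.integrable_of_hasCompactSupport ?_
  refine HasCompactSupport.intro (isCompact_closedBall (0 : EuclideanSpace ℝ (Fin n)) r) ?_
  intro x hx
  rw [Metric.mem_closedBall, dist_zero_right, not_le] at hx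
  exact h0 x hx

/-- A continuous function times the weight is integrable. -/
theorem integrable_mul_wt {r : ℝ} (hr : 0 ≤ r) {F : EuclideanSpace ℝ (Fin n) → ℝ}
    (hF : Continuous F) : Integrable fun x => F x * max (r ^ 2 - ‖x‖ ^ 2) 0 := by
  apply integrable_of_eq_zero_outside (r := r) (hF.mul (continuous_wt r))
  intro x hx
  simp [wt_eq_zero_of_lt hr hx]

/-- A continuous function times the squared weight is integrable. -/
theorem integrable_mul_wt_sq {r : ℝ} (hr : 0 ≤ r) {F : EuclideanSpace ℝ (Fin n) → ℝ}
    (hF : Continuous F) : Integrable fun x => F x * (max (r ^ 2 - ‖x‖ ^ 2) 0) ^ 2 := by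
  apply integrable_of_eq_zero_outside (r := r) (hF.mul ((continuous_wt r).pow 2))
  intro x hx
  simp [wt_eq_zero_of_lt hr hx]

/-- `t ↦ (max t 0)²` is differentiable with derivative `2 · max t 0`. -/
theorem hasDerivAt_max_sq (s : ℝ) : HasDerivAt (fun t : ℝ => (max t 0) ^ 2) (2 * max s 0) s := by
  rcases lt_trichotomy s 0 with hs | rfl | hs
  · have : (fun t : ℝ => (max t 0) ^ 2) =ᶠ[nhds s] fun _ => 0 := by
      filter_upwards [gt_mem_nhds hs] with t ht
      simp [max_eq_right ht.le]
    rw [max_eq_right hs.le, mul_zero]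
    exact (hasDerivAt_const s (0:ℝ)).congr_of_eventuallyEq this
  · rw [max_self, mul_zero, hasDerivAt_iff_isLittleO_nhds_zero]
    simp only [zero_add, max_self, ne_eq, OfNat.ofNat_ne_zero, not_false_eq_true, zero_pow,
      sub_zero, smul_zero]
    have h1 : (fun h : ℝ => (max h 0) ^ 2) =O[nhds 0] fun h : ℝ => h ^ 2 := by
      apply Asymptotics.IsBigO.of_bound 1
      filter_upwards with h
      rw [one_mul, Real.norm_eq_abs, Real.norm_eq_abs, abs_pow, abs_pow]
      apply pow_le_pow_left₀ (abs_nonneg _)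
      rcases le_total h 0 with hh | hh
      · simp [max_eq_right hh]
      · simp [max_eq_left hh]
    exact h1.trans_isLittleO (Asymptotics.isLittleO_pow_id one_lt_two)
  · have : (fun t : ℝ => (max t 0) ^ 2) =ᶠ[nhds s] fun t => t ^ 2 := by
      filter_upwards [lt_mem_nhds hs] with t ht
      simp [max_eq_left ht.le]
    rw [max_eq_left hs.le]
    refine HasDerivAt.congr_of_eventuallyEq ?_ this
    simpa using hasDerivAt_pow 2 s

/-- Line derivative of the squared weight in direction `v`:
`∂ᵥ (max (r² − ‖x‖²) 0)² = −4⟪x,v⟫ · max (r² − ‖x‖²) 0`. -/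
theorem hasLineDerivAt_wt_sq (r : ℝ) (x v : EuclideanSpace ℝ (Fin n)) :
    HasLineDerivAt ℝ (fun y : EuclideanSpace ℝ (Fin n) => (max (r ^ 2 - ‖y‖ ^ 2) 0) ^ 2)
      (-(4 * ⟪x, v⟫_ℝ * max (r ^ 2 - ‖x‖ ^ 2) 0)) x v := by
  unfold HasLineDerivAt
  have h1 : HasDerivAt (fun t : ℝ => x + t • v) v 0 := by
    simpa using ((hasDerivAt_id (0:ℝ)).smul_const v).const_add x
  have h2 : HasDerivAt (fun t : ℝ => ‖x + t • v‖ ^ 2) (2 * ⟪x, v⟫_ℝ) 0 := by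
    have := h1.norm_sq
    simpa using this
  have h3 : HasDerivAt (fun t : ℝ => r ^ 2 - ‖x + t • v‖ ^ 2) (-(2 * ⟪x, v⟫_ℝ)) 0 := by
    simpa using h2.const_sub (r ^ 2)
  have h4 := (hasDerivAt_max_sq (r ^ 2 - ‖x + (0:ℝ) • v‖ ^ 2)).comp (0:ℝ) h3
  simp only [zero_smul, add_zero] at h4
  exact h4.congr_deriv (by ring)

/-- Line derivative of `y ↦ ⟪w, y⟫ ^ m` in direction `v`. -/
theorem hasLineDerivAt_inner_pow (w x v : EuclideanSpace ℝ (Fin n)) (m : ℕ) :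
    HasLineDerivAt ℝ (fun y => ⟪w, y⟫_ℝ ^ m) ((m : ℝ) * ⟪w, x⟫_ℝ ^ (m - 1) * ⟪w, v⟫_ℝ) x v := by
  unfold HasLineDerivAt
  have h1 : HasDerivAt (fun t : ℝ => ⟪w, x⟫_ℝ + t * ⟪w, v⟫_ℝ) (⟪w, v⟫_ℝ) 0 := by
    simpa using ((hasDerivAt_id (0:ℝ)).mul_const ⟪w, v⟫_ℝ).const_add ⟪w, x⟫_ℝ
  have h2 : HasDerivAt (fun t : ℝ => (⟪w, x⟫_ℝ + t * ⟪w, v⟫_ℝ) ^ m)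
      ((m : ℝ) * (⟪w, x⟫_ℝ + 0 * ⟪w, v⟫_ℝ) ^ (m - 1) * ⟪w, v⟫_ℝ) 0 := h1.pow m
  simp only [zero_mul, add_zero] at h2
  have : (fun t : ℝ => ⟪w, x + t • v⟫_ℝ ^ m) = fun t => (⟪w, x⟫_ℝ + t * ⟪w, v⟫_ℝ) ^ m := by
    ext t
    rw [inner_add_right, real_inner_smul_right]
  rw [this]
  exact h2

/-- Line derivative of `y ↦ y k * ⟪w, y⟫ ^ m` in the coordinate direction `k`. -/
theorem hasLineDerivAt_coord_mul_inner_pow (w x : EuclideanSpace ℝ (Fin n)) (k : Fin n) (m : ℕ) :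
    HasLineDerivAt ℝ (fun y => y k * ⟪w, y⟫_ℝ ^ m)
      (⟪w, x⟫_ℝ ^ m + x k * ((m : ℝ) * ⟪w, x⟫_ℝ ^ (m - 1) * w k)) x
      (EuclideanSpace.single k 1) := by
  unfold HasLineDerivAt
  have h1 : HasDerivAt (fun t : ℝ => ⟪w, x⟫_ℝ + t * w k) (w k) 0 := by
    simpa using ((hasDerivAt_id (0:ℝ)).mul_const (w k)).const_add ⟪w, x⟫_ℝ
  have h2 : HasDerivAt (fun t : ℝ => (⟪w, x⟫_ℝ + t * w k) ^ m)
      ((m : ℝ) * (⟪w, x⟫_ℝ + 0 * w k) ^ (m - 1) * w k) 0 := h1.pow m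
  have h3 : HasDerivAt (fun t : ℝ => x k + t) 1 0 := by
    simpa using (hasDerivAt_id (0:ℝ)).const_add (x k)
  have h4 := h3.mul h2
  simp only [zero_mul, add_zero, one_mul] at h4
  have : (fun t : ℝ => (x + t • EuclideanSpace.single k (1:ℝ)) k *
      ⟪w, x + t • EuclideanSpace.single k (1:ℝ)⟫_ℝ ^ m)
      = fun t => (x k + t) * (⟪w, x⟫_ℝ + t * w k) ^ m := by
    ext t
    rw [inner_add_right, real_inner_smul_right, EuclideanSpace.inner_single_right]
    simp
  rw [this]
  exact h4

/-- Integration by parts against the squared weight, in direction `v`: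
`∫ f · 4⟪x,v⟫ · (r² − ‖x‖²)₊ = ∫ (∂ᵥ f) · (r² − ‖x‖²)₊²`. -/
theorem integral_mul_inner_mul_wt {r : ℝ} (hr : 0 ≤ r) (v : EuclideanSpace ℝ (Fin n))
    {f f' : EuclideanSpace ℝ (Fin n) → ℝ} (hf : Continuous f) (hf' : Continuous f')
    (hderiv : ∀ x, HasLineDerivAt ℝ f (f' x) x v) :
    ∫ x, f x * (4 * ⟪x, v⟫_ℝ * max (r ^ 2 - ‖x‖ ^ 2) 0)
      = ∫ x, f' x * (max (r ^ 2 - ‖x‖ ^ 2) 0) ^ 2 := by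
  have key := integral_bilinear_hasLineDerivAt_right_eq_neg_left_of_integrable
    (μ := (volume : Measure (EuclideanSpace ℝ (Fin n))))
    (B := ContinuousLinearMap.mul ℝ ℝ) (f := f) (f' := f')
    (g := fun x : EuclideanSpace ℝ (Fin n) => (max (r ^ 2 - ‖x‖ ^ 2) 0) ^ 2)
    (g' := fun x => -(4 * ⟪x, v⟫_ℝ * max (r ^ 2 - ‖x‖ ^ 2) 0)) (v := v) ?_ ?_ ?_
    (fun x _ => hderiv x) (fun x _ => hasLineDerivAt_wt_sq r x v)
  · simp only [ContinuousLinearMap.mul_apply'] at key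
    have h1 : ∫ x, f x * -(4 * ⟪x, v⟫_ℝ * max (r ^ 2 - ‖x‖ ^ 2) 0)
        = -∫ x, f x * (4 * ⟪x, v⟫_ℝ * max (r ^ 2 - ‖x‖ ^ 2) 0) := by
      rw [← integral_neg]
      congr 1
      ext x
      ring
    rw [h1] at key
    linarith
  · simp only [ContinuousLinearMap.mul_apply']
    exact integrable_mul_wt_sq hr hf'
  · simp only [ContinuousLinearMap.mul_apply']
    have hi : Continuous fun x : EuclideanSpace ℝ (Fin n) => ⟪x, v⟫_ℝ := by fun_prop
    have := integrable_mul_wt hr (F := fun x => -(f x * (4 * ⟪x, v⟫_ℝ))) (by fun_prop)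
    refine this.congr (Filter.Eventually.of_forall fun x => ?_)
    dsimp only
    ring
  · simp only [ContinuousLinearMap.mul_apply']
    exact integrable_mul_wt_sq hr hf

/-- First moment identity (direction `w`):
`4 ∫ ⟪w,x⟫^{2i+2} (r² − ‖x‖²)₊ = (2i+1) ‖w‖² ∫ ⟪w,x⟫^{2i} (r² − ‖x‖²)₊²`. -/
theorem four_mul_moment_succ {r : ℝ} (hr : 0 ≤ r) (w : EuclideanSpace ℝ (Fin n)) (i : ℕ) :
    4 * ∫ x : EuclideanSpace ℝ (Fin n), ⟪w, x⟫_ℝ ^ (2 * (i + 1)) * max (r ^ 2 - ‖x‖ ^ 2) 0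
      = (2 * i + 1) * ‖w‖ ^ 2 *
        ∫ x : EuclideanSpace ℝ (Fin n), ⟪w, x⟫_ℝ ^ (2 * i) * (max (r ^ 2 - ‖x‖ ^ 2) 0) ^ 2 := by
  have hcont : Continuous fun x : EuclideanSpace ℝ (Fin n) => ⟪w, x⟫_ℝ := by fun_prop
  have key := integral_mul_inner_mul_wt hr w (f := fun x => ⟪w, x⟫_ℝ ^ (2 * i + 1))
    (f' := fun x => ((2 * i + 1 : ℕ) : ℝ) * ⟪w, x⟫_ℝ ^ (2 * i + 1 - 1) * ⟪w, w⟫_ℝ)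
    (by fun_prop) (by fun_prop) (fun x => hasLineDerivAt_inner_pow w x w (2 * i + 1))
  have h1 : (fun x : EuclideanSpace ℝ (Fin n) =>
      ⟪w, x⟫_ℝ ^ (2 * i + 1) * (4 * ⟪x, w⟫_ℝ * max (r ^ 2 - ‖x‖ ^ 2) 0))
      = fun x => 4 * (⟪w, x⟫_ℝ ^ (2 * (i + 1)) * max (r ^ 2 - ‖x‖ ^ 2) 0) := by
    ext x
    rw [real_inner_comm w x]
    ring
  have h2 : (fun x : EuclideanSpace ℝ (Fin n) =>
      ((2 * i + 1 : ℕ) : ℝ) * ⟪w, x⟫_ℝ ^ (2 * i + 1 - 1) * ⟪w, w⟫_ℝ * (max (r ^ 2 - ‖x‖ ^ 2) 0) ^ 2)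
      = fun x => ((2 * i + 1 : ℝ) * ‖w‖ ^ 2) *
          (⟪w, x⟫_ℝ ^ (2 * i) * (max (r ^ 2 - ‖x‖ ^ 2) 0) ^ 2) := by
    ext x
    rw [real_inner_self_eq_norm_sq]
    simp only [Nat.add_sub_cancel]
    push_cast
    ring
  rw [h1, h2, integral_const_mul, integral_const_mul] at key
  linarith

/-- Pointwise: `‖x‖² · (r² − ‖x‖²)₊ = r² · (r² − ‖x‖²)₊ − (r² − ‖x‖²)₊²`. -/
theorem norm_sq_mul_wt (r : ℝ) (x : EuclideanSpace ℝ (Fin n)) :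
    ‖x‖ ^ 2 * max (r ^ 2 - ‖x‖ ^ 2) 0
      = r ^ 2 * max (r ^ 2 - ‖x‖ ^ 2) 0 - (max (r ^ 2 - ‖x‖ ^ 2) 0) ^ 2 := by
  rcases le_total (r ^ 2 - ‖x‖ ^ 2) 0 with h | h
  · simp [max_eq_right h]
  · rw [max_eq_left h]
    ring

/-- Second moment identity (radial field, summed over the coordinate directions):
`(n + 2i + 4) ∫ ⟪w,x⟫^{2i} (r² − ‖x‖²)₊² = 4 r² ∫ ⟪w,x⟫^{2i} (r² − ‖x‖²)₊`. -/
theorem momentSq_eq {r : ℝ} (hr : 0 ≤ r) (w : EuclideanSpace ℝ (Fin n)) (i : ℕ) :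
    ((n : ℝ) + 2 * i + 4) *
        ∫ x : EuclideanSpace ℝ (Fin n), ⟪w, x⟫_ℝ ^ (2 * i) * (max (r ^ 2 - ‖x‖ ^ 2) 0) ^ 2
      = 4 * r ^ 2 * ∫ x : EuclideanSpace ℝ (Fin n), ⟪w, x⟫_ℝ ^ (2 * i) * max (r ^ 2 - ‖x‖ ^ 2) 0 := by
  have hcont : Continuous fun x : EuclideanSpace ℝ (Fin n) => ⟪w, x⟫_ℝ := by fun_prop
  -- per-coordinate identity
  have hk : ∀ k : Fin n,
      ∫ x : EuclideanSpace ℝ (Fin n), (x k * ⟪w, x⟫_ℝ ^ (2 * i)) *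
          (4 * ⟪x, EuclideanSpace.single k (1:ℝ)⟫_ℝ * max (r ^ 2 - ‖x‖ ^ 2) 0)
        = ∫ x : EuclideanSpace ℝ (Fin n),
          (⟪w, x⟫_ℝ ^ (2 * i) + x k * (((2 * i : ℕ) : ℝ) * ⟪w, x⟫_ℝ ^ (2 * i - 1) * w k))
            * (max (r ^ 2 - ‖x‖ ^ 2) 0) ^ 2 := by
    intro k
    have hck : Continuous fun x : EuclideanSpace ℝ (Fin n) => x k := by fun_prop
    exact integral_mul_inner_mul_wt hr (EuclideanSpace.single k (1:ℝ))
      (f := fun x => x k * ⟪w, x⟫_ℝ ^ (2 * i))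
      (f' := fun x => ⟪w, x⟫_ℝ ^ (2 * i) + x k * (((2 * i : ℕ) : ℝ) * ⟪w, x⟫_ℝ ^ (2 * i - 1) * w k))
      (by fun_prop) (by fun_prop) (fun x => hasLineDerivAt_coord_mul_inner_pow w x k (2 * i))
  have hsum := Finset.sum_congr rfl (fun k (_ : k ∈ (Finset.univ : Finset (Fin n))) => hk k)
  -- pointwise simplification of the two summed integrands
  have hinner : ∀ x : EuclideanSpace ℝ (Fin n), ⟪w, x⟫_ℝ = ∑ k, x k * w k := by
    intro x
    simp [PiLp.inner_apply, RCLike.inner_apply]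
  have hpow : ∀ a : ℝ, ((2 * i : ℕ) : ℝ) * a ^ (2 * i - 1) * a = ((2 * i : ℕ) : ℝ) * a ^ (2 * i) := by
    intro a
    rcases Nat.eq_zero_or_pos i with hi | hi
    · subst hi; simp
    · rw [mul_assoc, pow_sub_one_mul (by omega)]
  have hL : ∀ x : EuclideanSpace ℝ (Fin n),
      ∑ k, (x k * ⟪w, x⟫_ℝ ^ (2 * i)) *
          (4 * ⟪x, EuclideanSpace.single k (1:ℝ)⟫_ℝ * max (r ^ 2 - ‖x‖ ^ 2) 0)
        = 4 * r ^ 2 * (⟪w, x⟫_ℝ ^ (2 * i) * max (r ^ 2 - ‖x‖ ^ 2) 0)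
          - 4 * (⟪w, x⟫_ℝ ^ (2 * i) * (max (r ^ 2 - ‖x‖ ^ 2) 0) ^ 2) := by
    intro x
    have h1 : ∑ k, (x k * ⟪w, x⟫_ℝ ^ (2 * i)) *
          (4 * ⟪x, EuclideanSpace.single k (1:ℝ)⟫_ℝ * max (r ^ 2 - ‖x‖ ^ 2) 0)
        = 4 * ⟪w, x⟫_ℝ ^ (2 * i) * (‖x‖ ^ 2 * max (r ^ 2 - ‖x‖ ^ 2) 0) := by
      rw [EuclideanSpace.real_norm_sq_eq, Finset.sum_mul, Finset.mul_sum]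
      refine Finset.sum_congr rfl ?_
      intro k _
      rw [EuclideanSpace.inner_single_right]
      simp only [conj_trivial, one_mul]
      ring
    rw [h1, norm_sq_mul_wt]
    ring
  have hR : ∀ x : EuclideanSpace ℝ (Fin n),
      ∑ k, (⟪w, x⟫_ℝ ^ (2 * i) + x k * (((2 * i : ℕ) : ℝ) * ⟪w, x⟫_ℝ ^ (2 * i - 1) * w k))
          * (max (r ^ 2 - ‖x‖ ^ 2) 0) ^ 2
        = ((n : ℝ) + 2 * i) * (⟪w, x⟫_ℝ ^ (2 * i) * (max (r ^ 2 - ‖x‖ ^ 2) 0) ^ 2) := by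
    intro x
    have h1 : ∑ k, (⟪w, x⟫_ℝ ^ (2 * i) + x k * (((2 * i : ℕ) : ℝ) * ⟪w, x⟫_ℝ ^ (2 * i - 1) * w k))
          * (max (r ^ 2 - ‖x‖ ^ 2) 0) ^ 2
        = (n : ℝ) * (⟪w, x⟫_ℝ ^ (2 * i) * (max (r ^ 2 - ‖x‖ ^ 2) 0) ^ 2)
          + (((2 * i : ℕ) : ℝ) * ⟪w, x⟫_ℝ ^ (2 * i - 1) * (max (r ^ 2 - ‖x‖ ^ 2) 0) ^ 2)
            * (∑ k, x k * w k) := by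
      calc ∑ k, (⟪w, x⟫_ℝ ^ (2 * i) + x k * (((2 * i : ℕ) : ℝ) * ⟪w, x⟫_ℝ ^ (2 * i - 1) * w k))
            * (max (r ^ 2 - ‖x‖ ^ 2) 0) ^ 2
          = ∑ k, (⟪w, x⟫_ℝ ^ (2 * i) * (max (r ^ 2 - ‖x‖ ^ 2) 0) ^ 2
              + (((2 * i : ℕ) : ℝ) * ⟪w, x⟫_ℝ ^ (2 * i - 1) * (max (r ^ 2 - ‖x‖ ^ 2) 0) ^ 2)
                * (x k * w k)) :=
            Finset.sum_congr rfl (fun k _ => by ring)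
        _ = (n : ℝ) * (⟪w, x⟫_ℝ ^ (2 * i) * (max (r ^ 2 - ‖x‖ ^ 2) 0) ^ 2)
          + (((2 * i : ℕ) : ℝ) * ⟪w, x⟫_ℝ ^ (2 * i - 1) * (max (r ^ 2 - ‖x‖ ^ 2) 0) ^ 2)
            * (∑ k, x k * w k) := by
            rw [Finset.sum_add_distrib, Finset.sum_const, Finset.card_univ, Fintype.card_fin,
              nsmul_eq_mul, Finset.mul_sum]
    rw [h1, ← hinner]
    have h2 := hpow ⟪w, x⟫_ℝ
    push_cast at h2 ⊢
    linear_combination ((max (r ^ 2 - ‖x‖ ^ 2) 0) ^ 2) * h2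
  -- swap sums and integrals
  have hintL : ∀ k ∈ (Finset.univ : Finset (Fin n)), Integrable (fun x : EuclideanSpace ℝ (Fin n) =>
      (x k * ⟪w, x⟫_ℝ ^ (2 * i)) *
        (4 * ⟪x, EuclideanSpace.single k (1:ℝ)⟫_ℝ * max (r ^ 2 - ‖x‖ ^ 2) 0)) := by
    intro k _
    have h1 : Continuous fun x : EuclideanSpace ℝ (Fin n) => x k := by fun_prop
    have h2 : Continuous fun x : EuclideanSpace ℝ (Fin n) =>
      ⟪x, EuclideanSpace.single k (1:ℝ)⟫_ℝ := by fun_prop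
    have := integrable_mul_wt hr
      (F := fun x => (x k * ⟪w, x⟫_ℝ ^ (2 * i)) * (4 * ⟪x, EuclideanSpace.single k (1:ℝ)⟫_ℝ))
      (by fun_prop)
    refine this.congr (Filter.Eventually.of_forall fun x => ?_)
    dsimp only
    ring
  have hintR : ∀ k ∈ (Finset.univ : Finset (Fin n)), Integrable (fun x : EuclideanSpace ℝ (Fin n) =>
      (⟪w, x⟫_ℝ ^ (2 * i) + x k * (((2 * i : ℕ) : ℝ) * ⟪w, x⟫_ℝ ^ (2 * i - 1) * w k))
        * (max (r ^ 2 - ‖x‖ ^ 2) 0) ^ 2) := by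
    intro k _
    have h1 : Continuous fun x : EuclideanSpace ℝ (Fin n) => x k := by fun_prop
    exact integrable_mul_wt_sq hr (by fun_prop)
  have hswapL : ∑ k, ∫ x : EuclideanSpace ℝ (Fin n),
      (x k * ⟪w, x⟫_ℝ ^ (2 * i)) *
        (4 * ⟪x, EuclideanSpace.single k (1:ℝ)⟫_ℝ * max (r ^ 2 - ‖x‖ ^ 2) 0)
      = ∫ x : EuclideanSpace ℝ (Fin n),
      ∑ k, (x k * ⟪w, x⟫_ℝ ^ (2 * i)) *
        (4 * ⟪x, EuclideanSpace.single k (1:ℝ)⟫_ℝ * max (r ^ 2 - ‖x‖ ^ 2) 0) :=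
    (integral_finsetSum _ hintL).symm
  have hswapR : ∑ k, ∫ x : EuclideanSpace ℝ (Fin n),
      (⟪w, x⟫_ℝ ^ (2 * i) + x k * (((2 * i : ℕ) : ℝ) * ⟪w, x⟫_ℝ ^ (2 * i - 1) * w k))
        * (max (r ^ 2 - ‖x‖ ^ 2) 0) ^ 2
      = ∫ x : EuclideanSpace ℝ (Fin n),
      ∑ k, (⟪w, x⟫_ℝ ^ (2 * i) + x k * (((2 * i : ℕ) : ℝ) * ⟪w, x⟫_ℝ ^ (2 * i - 1) * w k))
        * (max (r ^ 2 - ‖x‖ ^ 2) 0) ^ 2 :=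
    (integral_finsetSum _ hintR).symm
  rw [hswapL, hswapR] at hsum
  simp_rw [hL, hR] at hsum
  -- evaluate the integrals
  have hI1 : Integrable (fun x : EuclideanSpace ℝ (Fin n) =>
      ⟪w, x⟫_ℝ ^ (2 * i) * max (r ^ 2 - ‖x‖ ^ 2) 0) := integrable_mul_wt hr (by fun_prop)
  have hI2 : Integrable (fun x : EuclideanSpace ℝ (Fin n) =>
      ⟪w, x⟫_ℝ ^ (2 * i) * (max (r ^ 2 - ‖x‖ ^ 2) 0) ^ 2) := integrable_mul_wt_sq hr (by fun_prop)
  rw [integral_sub (hI1.const_mul _) (hI2.const_mul _), integral_const_mul, integral_const_mul,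
    integral_const_mul] at hsum
  linarith

/-- **Moment recursion.** For the radial weight `(r² − ‖x‖²)₊` on `ℝⁿ` and any `w`,
`(n + 2i + 4) ∫ ⟪w,x⟫^{2i+2} (r² − ‖x‖²)₊ dx = (2i+1) ‖w‖² r² ∫ ⟪w,x⟫^{2i} (r² − ‖x‖²)₊ dx`. -/
theorem moment_succ {r : ℝ} (hr : 0 ≤ r) (w : EuclideanSpace ℝ (Fin n)) (i : ℕ) :
    ((n : ℝ) + 2 * i + 4) *
        ∫ x : EuclideanSpace ℝ (Fin n), ⟪w, x⟫_ℝ ^ (2 * (i + 1)) * max (r ^ 2 - ‖x‖ ^ 2) 0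
      = (2 * i + 1) * ‖w‖ ^ 2 * r ^ 2 *
        ∫ x : EuclideanSpace ℝ (Fin n), ⟪w, x⟫_ℝ ^ (2 * i) * max (r ^ 2 - ‖x‖ ^ 2) 0 := by
  have h1 := four_mul_moment_succ hr w i
  have h2 := momentSq_eq hr w i
  linear_combination (1 / 4 : ℝ) * ((n : ℝ) + 2 * i + 4) * h1
    + (1 / 4 : ℝ) * (2 * i + 1) * ‖w‖ ^ 2 * h2

end Summit.PneNP.PneNP.Theorems.TaylorMinorants
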